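import Literature.Algebra.EuclideanLattices.RankinSumsOfLinearForms
import Mathlib.Algebra.Module.ZLattice.Covolume
import Mathlib.GroupTheory.Index
import Mathlib.GroupTheory.OrderOfElement
import HarnessLib

/-!
# Rankin's `ℓ₁` bound on a finite-index sublattice

Topic `Literature/Algebra/EuclideanLattices`. Everything in this file is PROVED (no named facts,
no definitions).

`Literature.Algebra.EuclideanLattices.Rankin.exists_ne_zero_l1_le` (Rankin 1948, in the finite
form of `RankinSumsOfLinearForms.lean`) bounds the `ℓ₁`-length of a shortest non-zero vector of a
full lattice `span_ℤ(b) ⊆ ℝ^N` by `C(N, q, ρ) · |det b|^{1/N}`. Here it is pushed to the sublattice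
cut out by a finite-index subgroup `K ⊆ ℤ^N` of coefficient vectors:
`{∑ e_i b_i : e ∈ K}` is again a full lattice, of covolume `[ℤ^N : K] · |det b|`
(Mathlib's `ZLattice.covolume_div_covolume_eq_relIndex`), so it has a non-zero vector
`∑ e_i b_i`, `e ∈ K`, with `∑_t |(∑ e_i b_i)_t| ≤ C(N, q, ρ) · ([ℤ^N : K] |det b|)^{1/N}`
(`exists_mem_ne_zero_l1_le_of_finiteIndex`). This is the form in which the bound is used for
the *kernel sublattice* of the odd-prime-number lattice in C. Bright, *A new lower bound in the
abc conjecture*, Canad. Math. Bull. 67 (2024), §2.2–2.4 and Lemma 3.1 (index `2^{m-1}` of the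
vectors whose `S`-unit is `≡ 1 (mod 2^m)`).

## References

* C. Bright, *A new lower bound in the abc conjecture*, Canad. Math. Bull. 67 (2024) 369–378,
  §2.2 (Lemma 2.2), §2.4 (Lemma 2.5), §3 (Lemma 3.1) [Bright2024].
* R. A. Rankin, *On sums of powers of linear forms III*, Proc. Kon. Ned. Akad. Wetensch. 51
  (1948) 846–853 [Rankin1948].
-/

noncomputable section

open Module MeasureTheory

namespace Literature.Algebra.EuclideanLattices.Rankin

variable {ι : Type*} [Fintype ι] [DecidableEq ι]

omit [DecidableEq ι] in
/-- The coefficient isomorphism `ℤ^ι ≃ span_ℤ(b)`, `e ↦ ∑ e_i b_i`, evaluated in the ambient space.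
[folklore] -/
theorem coe_restrictScalars_equivFun_symm (b : Basis ι ℝ (ι → ℝ)) (e : ι → ℤ) :
    (((b.restrictScalars ℤ).equivFun.symm e : Submodule.span ℤ (Set.range b)) : ι → ℝ)
      = ∑ i, (e i : ℝ) • b i := by
  rw [Basis.equivFun_symm_apply, Submodule.coe_sum]
  refine Finset.sum_congr rfl fun i _ => ?_
  rw [Submodule.coe_smul, Basis.restrictScalars_apply, Int.cast_smul_eq_zsmul]

/-- **Rankin's bound on a finite-index sublattice** (the covolume input of Bright 2024, Lemma 2.5
and Lemma 3.1). Let `b` be a basis of `ℝ^ι` (`ι` non-empty), `K ⊆ ℤ^ι` a subgroup of finite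
index, `q > 1`, `0 < ρ < 1`. Then some `e ∈ K`, `e ≠ 0`, has
`∑_t |(∑_i e_i b_i)_t| ≤ (2/(ρ R)) · (q [ℤ^ι : K] |det b| / ((1 - ρ^q) vol(B_q)))^{1/N}`, with
`R^q = ((2q-1)/(q-1))^{q-1} N^{1-q}`, `vol(B_q) = (2Γ(1/q+1))^N / Γ(N/q+1)`, `N = |ι|`: the set
`{∑ e_i b_i : e ∈ K}` is a full lattice of covolume `[ℤ^ι : K] · |det b|`, to which
`exists_ne_zero_l1_le` applies. [cite: Bright2024, Lemma 2.5 and Lemma 3.1] -/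
theorem exists_mem_ne_zero_l1_le_of_finiteIndex (b : Basis ι ℝ (ι → ℝ)) (K : AddSubgroup (ι → ℤ))
    [K.FiniteIndex] {q : ℝ} (hq : 1 < q) (hN : 0 < Fintype.card ι) {ρ : ℝ} (hρ0 : 0 < ρ)
    (hρ1 : ρ < 1) :
    ∃ e : ι → ℤ, e ∈ K ∧ e ≠ 0 ∧
      ∑ t, |(∑ i, (e i : ℝ) • b i) t| ≤ 2 / (ρ * (((2 * q - 1) / (q - 1)) ^ (q - 1)
          * (Fintype.card ι : ℝ) ^ (1 - q)) ^ (1 / q)) *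
        (q * ((K.index : ℝ) * |(Matrix.of b).det|) / ((1 - ρ ^ q) *
          ((2 * Real.Gamma (1 / q + 1)) ^ Fintype.card ι / Real.Gamma (Fintype.card ι / q + 1))))
          ^ (1 / (Fintype.card ι : ℝ)) := by
  classical
  -- the ambient lattice `L₂ = span_ℤ(b)` and the coefficient isomorphism `Φ : ℤ^ι ≃ L₂`
  set L₂ : Submodule ℤ (ι → ℝ) := Submodule.span ℤ (Set.range b) with hL₂
  let bZ : Basis ι ℤ L₂ := b.restrictScalars ℤ
  let Φ : (ι → ℤ) ≃ₗ[ℤ] L₂ := bZ.equivFun.symm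
  have hΦ : ∀ e : ι → ℤ, ((Φ e : L₂) : ι → ℝ) = ∑ i, (e i : ℝ) • b i :=
    fun e => coe_restrictScalars_equivFun_symm b e
  -- the sublattice `L₁ = Φ(K)`
  set L₁ : Submodule ℤ (ι → ℝ) :=
    ((AddSubgroup.toIntSubmodule K).map (Φ : (ι → ℤ) →ₗ[ℤ] L₂)).map L₂.subtype with hL₁
  have hle : L₁ ≤ L₂ := by
    intro v hv
    rw [hL₁, Submodule.mem_map] at hv
    obtain ⟨w, -, rfl⟩ := hv
    exact w.2
  have hmemL₁ : ∀ {e : ι → ℤ}, e ∈ K → (∑ i, (e i : ℝ) • b i) ∈ L₁ := by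
    intro e he
    rw [hL₁, Submodule.mem_map]
    refine ⟨Φ e, Submodule.mem_map.2 ⟨e, (show e ∈ K.toIntSubmodule from he), rfl⟩, ?_⟩
    exact hΦ e
  -- `L₁` is a full lattice
  haveI hdisc₂ : DiscreteTopology L₂ :=
    (inferInstance : DiscreteTopology (Submodule.span ℤ (Set.range b)))
  haveI hlat₂ : IsZLattice ℝ L₂ :=
    (inferInstance : IsZLattice ℝ (Submodule.span ℤ (Set.range b)))
  haveI hdisc : DiscreteTopology L₁ :=
    DiscreteTopology.of_subset (s := (L₂ : Set (ι → ℝ))) hdisc₂ hle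
  have hidx0 : K.index ≠ 0 := AddSubgroup.FiniteIndex.index_ne_zero
  haveI hlat : IsZLattice ℝ L₁ := by
    refine ⟨?_⟩
    rw [eq_top_iff, ← b.span_eq, Submodule.span_le]
    rintro _ ⟨i, rfl⟩
    have hK : K.index • (Pi.single i 1 : ι → ℤ) ∈ K := AddSubgroup.nsmul_index_mem K _
    have hmem : ((K.index : ℝ) • b i) ∈ L₁ := by
      have h := hmemL₁ hK
      have hsum : ∑ j, (((K.index • (Pi.single i 1 : ι → ℤ)) j : ℤ) : ℝ) • b j
          = (K.index : ℝ) • b i := by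
        rw [Finset.sum_eq_single i]
        · simp
        · intro j _ hj
          simp [hj]
        · intro h; exact absurd (Finset.mem_univ i) h
      rwa [hsum] at h
    have hk : (K.index : ℝ) ≠ 0 := by exact_mod_cast hidx0
    have : b i = (K.index : ℝ)⁻¹ • ((K.index : ℝ) • b i) := by
      rw [smul_smul, inv_mul_cancel₀ hk, one_smul]
    rw [SetLike.mem_coe, this]
    exact Submodule.smul_mem _ _ (Submodule.subset_span hmem)
  -- a basis of `L₁` and Rankin's theorem for it
  let b₁ : Basis ι ℤ L₁ := IsZLattice.basis L₁
  let B₁ : Basis ι ℝ (ι → ℝ) := b₁.ofZLatticeBasis ℝ L₁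
  obtain ⟨v, hv, hv0, hvle⟩ := exists_ne_zero_l1_le B₁ hq hN hρ0 hρ1
  rw [Basis.ofZLatticeBasis_span] at hv
  -- `v = ∑ e_i b_i` with `e ∈ K`
  have hv' := hv
  rw [hL₁, Submodule.mem_map] at hv'
  obtain ⟨w, hw, hwv⟩ := hv'
  rw [Submodule.mem_map] at hw
  obtain ⟨e, he, hew⟩ := hw
  replace he : e ∈ K := he
  have hve : v = ∑ i, (e i : ℝ) • b i := by
    rw [← hwv, ← hew]
    exact hΦ e
  have he0 : e ≠ 0 := by
    rintro rfl
    apply hv0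
    rw [hve]
    simp
  -- the covolume of `L₁`
  have hcov₁ : ZLattice.covolume L₁ = |(Matrix.of B₁).det| := by
    rw [ZLattice.covolume_eq_det L₁ b₁]
    congr 3
    funext i
    exact (b₁.ofZLatticeBasis_apply ℝ L₁ i).symm
  have hcov₂ : ZLattice.covolume L₂ = |(Matrix.of b).det| := by
    rw [ZLattice.covolume_eq_det L₂ bZ]
    congr 3
    funext i
    exact Basis.restrictScalars_apply ℤ b i
  have hrel : L₁.toAddSubgroup.relIndex L₂.toAddSubgroup = K.index := by
    rw [AddSubgroup.relIndex]
    have hsub : L₁.toAddSubgroup.addSubgroupOf L₂.toAddSubgroup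
        = K.map (Φ : (ι → ℤ) ≃ₗ[ℤ] L₂).toAddMonoidHom := by
      ext w
      simp only [AddSubgroup.mem_addSubgroupOf, Submodule.mem_toAddSubgroup, AddSubgroup.mem_map,
        LinearMap.toAddMonoidHom_coe, LinearEquiv.coe_coe]
      constructor
      · intro hw
        rw [hL₁, Submodule.mem_map] at hw
        obtain ⟨w', hw', hww⟩ := hw
        have : w' = w := Subtype.ext hww
        subst this
        rw [Submodule.mem_map] at hw'
        obtain ⟨e', he', rfl⟩ := hw'
        exact ⟨e', (show e' ∈ K from he'), rfl⟩
      · rintro ⟨e', he', rfl⟩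
        rw [hL₁, Submodule.mem_map]
        exact ⟨Φ e', Submodule.mem_map.2 ⟨e', (show e' ∈ K.toIntSubmodule from he'), rfl⟩, rfl⟩
    rw [hsub]
    exact AddSubgroup.index_map_of_bijective (LinearEquiv.bijective _) K
  have hquot := ZLattice.covolume_div_covolume_eq_relIndex L₁ L₂ hle
  rw [hrel, hcov₁, hcov₂, div_eq_iff (by
    rw [← hcov₂]; exact (ZLattice.covolume_pos L₂ volume).ne')] at hquot
  -- conclusion
  refine ⟨e, he, he0, ?_⟩
  rw [← hve, ← hquot]
  exact hvle

end Literature.Algebra.EuclideanLattices.Rankin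

end
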